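import Summits.Parity.GeneralizedHardyLittlewood.Theorems.LeeYangFibresRelativeDimOneMoebiusSplitStubDefs
import Summits.Parity.GeneralizedHardyLittlewood.Theorems.LeeYangFibresRelativeDimOneMoebiusSplitTermBoundAux3
import Summits.Parity.GeneralizedHardyLittlewood.Theorems.LeeYangFibresRelativeDimOneMoebiusSplitMoebiusTermBVAux7
import Literature.NumberTheory.Sieve.GreenTao2008SharpGYDiagonal
import Mathlib
import HarnessLib

/-!
# Route `LeeYangFibres`, crux `RelativeDimOne` (stmt-Parity-14113), line `single-moebius-split`,
# stub `stub_tssCompose` (T1b-C) — auxiliary file 2: the root data of a non-degenerate `d = 1`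
# system satisfy the hypotheses of the general-data induction `TSSInduction`

For a non-degenerate system `Ψ = (ψ_i)_{i<t}`, `ψ_i(n) = a_i n + b_i`, of size `‖Ψ‖_N ≤ L`
(`|a_i| ≤ L`, `|b_i| ≤ L N`) write `Π := ∏_i |a_i| · ∏_{i ≠ i'} |a_i b_{i'} − a_{i'} b_i|`, a positive
integer `≤ N^{2t²}` once `N ≥ 2(L+1)²`, and let `Q` be the set of its prime factors (the ROUGH primes):

* `tssC_rootSet_generic` — at a prime dividing no `a_i` and no minor (in particular at every prime
  `p ∉ Q`) the root sets `Z_{p,i} = {r mod p : p ∣ ψ_i(r)}` are singletons `{r_i}`, `r_i ≡ −b_i/a_i`,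
  pairwise distinct (GENERIC primes);
* at every prime `p > L` (so `p ∤ a_i`), `|Z_{p,i}| ≤ 1` (tree `card_rootSet_le_one`);
* `|Q| log 2 ≤ log Π ≤ 2t² log N` (`2^{|Q|} ≤ ∏ Q ≤ Π`, tree
  `GreenTao2008.SharpGY.card_primeFactors_mul_log_two_le`);
* `tssC_prod_primeFactors_pow_le` — `∏_{p∈Q} (p/(p−1))^t ≤ (2e⁵ log(3⁹ Π))^t ≤ (2e⁵ (2t²+10) log N)^t`
  (Landau's `m/φ(m) ≤ 2e⁵ log log m`, tree `prod_primeFactors_le_loglog'`);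
* `tssC_data` — the registered sub-goal packaging the four facts.

References: D. A. Goldston, C. Y. Yıldırım, Integers 3 (2003) A5 = arXiv:math/0111212, §3
[GoldstonYildirim2001]; B. Green, T. Tao, Ann. of Math. 171 (2010), Lemma 1.3 and App. D [GreenTao2010].
-/

noncomputable section

open scoped BigOperators Classical
open Finset Literature.NumberTheory.Sieve

namespace Summit.Parity.GeneralizedHardyLittlewood.Cruxes.RelativeDimOne.SingleMoebiusSplit

variable {t : ℕ}

/-! ### Generic primes -/

/-- **Generic primes.** At a prime `p` dividing no leading coefficient `a_i` and no minor
`a_i b_j − a_j b_i` (`i ≠ j`), every root set is a singleton `{r_i}` with `r_i < p`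
(`r_i ≡ −b_i a_i⁻¹ (mod p)`; uniqueness is `card_rootSet_le_one`), and `r_i` lies in no other root
set: `p ∣ a_i r + b_i` and `p ∣ a_j r + b_j` force `p ∣ a_i (a_j r + b_j) − a_j (a_i r + b_i) = a_i b_j − a_j b_i`. -/
theorem tssC_rootSet_generic (Ψ : Fin t → AffLinForm 1) {p : ℕ} (hp : p.Prime)
    (ha : ∀ i, ¬ (p : ℤ) ∣ (Ψ i).coeff 0)
    (hΔ : ∀ i j, i ≠ j → ¬ (p : ℤ) ∣ (Ψ i).coeff 0 * (Ψ j).const - (Ψ j).coeff 0 * (Ψ i).const)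
    (i : Fin t) :
    ∃ r : ℕ, r < p ∧ rootSet Ψ p i = {r} ∧ ∀ j : Fin t, j ≠ i → r ∉ rootSet Ψ p j := by
  haveI := Fact.mk hp
  have hai : (((Ψ i).coeff 0 : ℤ) : ZMod p) ≠ 0 := by
    rw [Ne, ZMod.intCast_zmod_eq_zero_iff_dvd]
    exact ha i
  set x : ZMod p := -(((Ψ i).const : ℤ) : ZMod p) * (((Ψ i).coeff 0 : ℤ) : ZMod p)⁻¹ with hx
  have hdvd : (p : ℤ) ∣ (Ψ i).coeff 0 * (x.val : ℤ) + (Ψ i).const := by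
    rw [← ZMod.intCast_zmod_eq_zero_iff_dvd]
    push_cast
    rw [ZMod.natCast_zmod_val, hx, mul_left_comm, mul_inv_cancel₀ hai, mul_one, neg_add_cancel]
  have hmem : x.val ∈ rootSet Ψ p i := by
    rw [rootSet, Finset.mem_filter, Finset.mem_range, DimOne.eval_eq]
    exact ⟨ZMod.val_lt x, hdvd⟩
  refine ⟨x.val, ZMod.val_lt x, ?_, fun j hji hmemj => ?_⟩
  · exact Finset.eq_singleton_iff_unique_mem.mpr
      ⟨hmem, fun y hy => Finset.card_le_one.mp (card_rootSet_le_one t Ψ p hp i (ha i)) y hy _ hmem⟩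
  · rw [rootSet, Finset.mem_filter, DimOne.eval_eq] at hmemj
    refine hΔ i j (Ne.symm hji) ?_
    have hdj : (p : ℤ) ∣ (Ψ j).coeff 0 * (x.val : ℤ) + (Ψ j).const := hmemj.2
    have e : (Ψ i).coeff 0 * (Ψ j).const - (Ψ j).coeff 0 * (Ψ i).const =
        (Ψ i).coeff 0 * ((Ψ j).coeff 0 * (x.val : ℤ) + (Ψ j).const) -
          (Ψ j).coeff 0 * ((Ψ i).coeff 0 * (x.val : ℤ) + (Ψ i).const) := by ring
    rw [e]
    exact dvd_sub (dvd_mul_of_dvd_right hdj _) (dvd_mul_of_dvd_right hdvd _)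

/-! ### The Landau bound for the rough primes -/

/-- `∏_{p ∣ n} (p/(p−1))^t ≤ (2e⁵ log(3⁹ X))^t` for `0 < n ≤ X`: enlarge to the prime factors of
`3⁹ n ≥ 3⁹` (the extra factors are `≥ 1`), apply Landau's `∏_{p ∣ m} p/(p−1) ≤ 2e⁵ log log m`
(`prod_primeFactors_le_loglog'`) and `log log m ≤ log m ≤ log(3⁹ X)`. -/
theorem tssC_prod_primeFactors_pow_le {n : ℕ} (hn : n ≠ 0) {X : ℝ} (hX : (n : ℝ) ≤ X) (t : ℕ) :
    ∏ p ∈ n.primeFactors, ((p : ℝ) / ((p : ℝ) - 1)) ^ t ≤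
      (2 * Real.exp 5 * Real.log (3 ^ 9 * X)) ^ t := by
  -- adapted from `termBound_aux_singularProduct_le` (…MoebiusSplitTermBoundAux3)
  set P1 : ℕ := 3 ^ 9 * n with hP1
  have hP19 : 3 ^ 9 ≤ P1 := Nat.le_mul_of_pos_right _ (Nat.pos_of_ne_zero hn)
  have hP10 : P1 ≠ 0 := by positivity
  have hsub : n.primeFactors ⊆ P1.primeFactors :=
    Nat.primeFactors_mono (Dvd.intro_left _ rfl) hP10
  have hP1X : (P1 : ℝ) ≤ 3 ^ 9 * X := by
    have h1 : (P1 : ℝ) = (3 : ℝ) ^ 9 * (n : ℝ) := by rw [hP1]; push_cast; ring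
    rw [h1]
    exact mul_le_mul_of_nonneg_left hX (by norm_num)
  have hP1pos : (0 : ℝ) < P1 := by exact_mod_cast Nat.pos_of_ne_zero hP10
  have hlogP1 : 0 < Real.log P1 :=
    Real.log_pos (by exact_mod_cast lt_of_lt_of_le (by norm_num) hP19)
  have hll : Real.log (Real.log P1) ≤ Real.log (3 ^ 9 * X) :=
    calc Real.log (Real.log P1) ≤ Real.log P1 - 1 := Real.log_le_sub_one_of_pos hlogP1
      _ ≤ Real.log P1 := by linarith
      _ ≤ Real.log (3 ^ 9 * X) := Real.log_le_log hP1pos hP1X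
  have hll0 : 0 ≤ Real.log (Real.log P1) := by linarith [two_le_loglog hP19]
  calc ∏ p ∈ n.primeFactors, ((p : ℝ) / ((p : ℝ) - 1)) ^ t
      ≤ ∏ p ∈ P1.primeFactors, ((p : ℝ) / ((p : ℝ) - 1)) ^ t := by
        refine Finset.prod_le_prod_of_subset_of_one_le hsub (fun p hp => ?_) fun p hp _ => ?_
        · exact pow_nonneg (div_pred_nonneg_one_le' (Nat.prime_of_mem_primeFactors hp).two_le).1 _
        · exact one_le_pow₀ (div_pred_nonneg_one_le' (Nat.prime_of_mem_primeFactors hp).two_le).2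
    _ = (∏ p ∈ P1.primeFactors, ((p : ℝ) / ((p : ℝ) - 1))) ^ t := Finset.prod_pow _ _ _
    _ ≤ (2 * Real.exp 5 * Real.log (Real.log P1)) ^ t :=
        pow_le_pow_left₀ (Finset.prod_nonneg fun p hp =>
          (div_pred_nonneg_one_le' (Nat.prime_of_mem_primeFactors hp).two_le).1)
          (prod_primeFactors_le_loglog' hP19) t
    _ ≤ (2 * Real.exp 5 * Real.log (3 ^ 9 * X)) ^ t :=
        pow_le_pow_left₀ (by positivity) (mul_le_mul_of_nonneg_left hll (by positivity)) t

/-! ### Sizes: the product of the coefficients and the minors -/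

/-- `|a_i| ≤ N²` and `|a_i b_j − a_j b_i| ≤ N²` for `‖Ψ‖_N ≤ L` and `N ≥ 2(L+1)²`
(`|a_i| ≤ L`, `|b_i| ≤ L N`, so the minors are `≤ 2L²N`). -/
theorem tssC_coeff_minor_le {Ψ : Fin t → AffLinForm 1} {L N : ℕ} (hN : 1 ≤ N)
    (hLN : 2 * (L + 1) ^ 2 ≤ N) (hL : affLinSize Ψ N ≤ L) (i j : Fin t) :
    ((Ψ i).coeff 0).natAbs ≤ N ^ 2 ∧
      ((Ψ i).coeff 0 * (Ψ j).const - (Ψ j).coeff 0 * (Ψ i).const).natAbs ≤ N ^ 2 := by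
  have hi := natAbs_le_of_affLinSize_le hN hL i
  have hj := natAbs_le_of_affLinSize_le hN hL j
  have hL1 : L + 1 ≤ (L + 1) ^ 2 := Nat.le_self_pow two_ne_zero (L + 1)
  have hNN : N ≤ N ^ 2 := Nat.le_self_pow two_ne_zero N
  have hsq : (L + 1) ^ 2 = (L + 1) * (L + 1) := sq (L + 1)
  refine ⟨by omega, ?_⟩
  calc ((Ψ i).coeff 0 * (Ψ j).const - (Ψ j).coeff 0 * (Ψ i).const).natAbs
      ≤ ((Ψ i).coeff 0 * (Ψ j).const).natAbs + ((Ψ j).coeff 0 * (Ψ i).const).natAbs :=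
        Int.natAbs_sub_le _ _
    _ = ((Ψ i).coeff 0).natAbs * ((Ψ j).const).natAbs +
          ((Ψ j).coeff 0).natAbs * ((Ψ i).const).natAbs := by rw [Int.natAbs_mul, Int.natAbs_mul]
    _ ≤ L * (L * N) + L * (L * N) :=
        Nat.add_le_add (Nat.mul_le_mul hi.1 hj.2) (Nat.mul_le_mul hj.1 hi.2)
    _ = (2 * (L * L)) * N := by ring
    _ ≤ (2 * (L + 1) ^ 2) * N := by
        refine Nat.mul_le_mul_right N (Nat.mul_le_mul_left 2 ?_)
        rw [hsq]
        exact Nat.mul_le_mul (Nat.le_succ L) (Nat.le_succ L)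
    _ ≤ N * N := Nat.mul_le_mul_right N hLN
    _ = N ^ 2 := (sq N).symm

/-! ### The registered sub-goal: the data of `Ψ` -/

/-- **T1b-C, data step** (registered sub-goal `tssC_data` for `stub_tssCompose`). For a
non-degenerate `d = 1` system `Ψ` of `t` forms with `‖Ψ‖_N ≤ L`, `N ≥ 3`, `N ≥ 2(L+1)²`, there is a
finite set `Q` of primes (the prime factors of `Π = ∏_i |a_i| ∏_{i≠i'} |a_i b_{i'} − a_{i'} b_i| ≤ N^{2t²}`)
with `|Q| log 2 ≤ 2t² log N` and `∏_{p∈Q} (p/(p−1))^t ≤ (2e⁵ (2t² + 10) log N)^t`, such that every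
prime `p > L` is ROUGH for the root data (`|Z_{p,i}| ≤ 1`) and every prime `p ∉ Q` is GENERIC
(the `Z_{p,i}` are pairwise distinct singletons) — the hypotheses of `TSSInduction t` off the frozen
small primes. -/
theorem tssC_data : ∀ (t L N : ℕ) (Ψ : Fin t → AffLinForm 1), IsNondegenerateSystem Ψ →
    3 ≤ N → 2 * (L + 1) ^ 2 ≤ N → affLinSize Ψ N ≤ L →
    ∃ Q : Finset ℕ, (∀ p ∈ Q, p.Prime) ∧
      (Q.card : ℝ) * Real.log 2 ≤ 2 * (t : ℝ) ^ 2 * Real.log N ∧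
      (∏ p ∈ Q, ((p : ℝ) / ((p : ℝ) - 1)) ^ t) ≤
        (2 * Real.exp 5 * ((2 * (t : ℝ) ^ 2 + 10) * Real.log N)) ^ t ∧
      (∀ p : ℕ, p.Prime → L < p → ∀ i : Fin t, (rootSet Ψ p i).card ≤ 1) ∧
      (∀ p : ℕ, p.Prime → p ∉ Q → ∀ i : Fin t, ∃ r : ℕ, r < p ∧ rootSet Ψ p i = {r} ∧
        ∀ j : Fin t, j ≠ i → r ∉ rootSet Ψ p j) := by
  intro t L N Ψ hΨ hN3 hLN hL
  have hN1 : 1 ≤ N := le_trans (by norm_num) hN3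
  -- the product `Π` of the coefficients and the minors
  set Pi : ℕ := (∏ i, ((Ψ i).coeff 0).natAbs) *
    ∏ ik ∈ (Finset.univ : Finset (Fin t)).offDiag,
      ((Ψ ik.1).coeff 0 * (Ψ ik.2).const - (Ψ ik.2).coeff 0 * (Ψ ik.1).const).natAbs with hPi
  have hPi0 : Pi ≠ 0 := mul_ne_zero
    (Finset.prod_ne_zero_iff.mpr fun i _ => Int.natAbs_ne_zero.mpr (coeff_zero_ne_zero hΨ i))
    (Finset.prod_ne_zero_iff.mpr fun ik hik =>
      Int.natAbs_ne_zero.mpr (minor_ne_zero' hΨ (Finset.mem_offDiag.mp hik).2.2))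
  have hdvdA : ∀ i, ((Ψ i).coeff 0).natAbs ∣ Pi := fun i =>
    (Finset.dvd_prod_of_mem (fun i => ((Ψ i).coeff 0).natAbs) (Finset.mem_univ i)).mul_right _
  have hdvdM : ∀ i j, i ≠ j →
      ((Ψ i).coeff 0 * (Ψ j).const - (Ψ j).coeff 0 * (Ψ i).const).natAbs ∣ Pi :=
    fun i j hij => (Finset.dvd_prod_of_mem (fun ik : Fin t × Fin t =>
      ((Ψ ik.1).coeff 0 * (Ψ ik.2).const - (Ψ ik.2).coeff 0 * (Ψ ik.1).const).natAbs)
      (a := (i, j)) (Finset.mem_offDiag.mpr ⟨Finset.mem_univ i, Finset.mem_univ j, hij⟩)).mul_left _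
  -- `Π ≤ N^{2t²}`
  have hPiN : Pi ≤ N ^ (2 * (t * t)) := by
    have hA : ∏ i, ((Ψ i).coeff 0).natAbs ≤ (N ^ 2) ^ t := by
      have h := Finset.prod_le_pow_card (Finset.univ : Finset (Fin t))
        (fun i => ((Ψ i).coeff 0).natAbs) (N ^ 2)
        fun i _ => (tssC_coeff_minor_le hN1 hLN hL i i).1
      rwa [Finset.card_univ, Fintype.card_fin] at h
    have hM : ∏ ik ∈ (Finset.univ : Finset (Fin t)).offDiag,
        ((Ψ ik.1).coeff 0 * (Ψ ik.2).const - (Ψ ik.2).coeff 0 * (Ψ ik.1).const).natAbs ≤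
          (N ^ 2) ^ (t * t - t) := by
      have h := Finset.prod_le_pow_card (Finset.univ : Finset (Fin t)).offDiag
        (fun ik : Fin t × Fin t =>
          ((Ψ ik.1).coeff 0 * (Ψ ik.2).const - (Ψ ik.2).coeff 0 * (Ψ ik.1).const).natAbs) (N ^ 2)
        fun ik _ => (tssC_coeff_minor_le hN1 hLN hL ik.1 ik.2).2
      rwa [Finset.offDiag_card, Finset.card_univ, Fintype.card_fin] at h
    calc Pi ≤ (N ^ 2) ^ t * (N ^ 2) ^ (t * t - t) := Nat.mul_le_mul hA hM
      _ = N ^ (2 * (t * t)) := by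
          rw [← pow_add, Nat.add_sub_cancel' (Nat.le_mul_self t), ← pow_mul]
  have hN0 : (0 : ℝ) < N := by exact_mod_cast hN1
  have hlogN : Real.log 3 ≤ Real.log N := Real.log_le_log (by norm_num) (by exact_mod_cast hN3)
  have hlog3 : 0 < Real.log 3 := Real.log_pos (by norm_num)
  have hPiR : (Pi : ℝ) ≤ (N : ℝ) ^ (2 * (t * t)) := by exact_mod_cast hPiN
  have htt : ((t : ℝ)) ^ 2 = (t : ℝ) * t := sq _
  refine ⟨Pi.primeFactors, fun p hp => Nat.prime_of_mem_primeFactors hp, ?_, ?_, ?_, ?_⟩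
  · -- `|Q| log 2 ≤ log Π ≤ 2t² log N`
    have h1 := GreenTao2008.SharpGY.card_primeFactors_mul_log_two_le hPi0
    have h2 : Real.log Pi ≤ Real.log ((N : ℝ) ^ (2 * (t * t))) :=
      Real.log_le_log (by exact_mod_cast Nat.pos_of_ne_zero hPi0) hPiR
    rw [Real.log_pow] at h2
    push_cast at h2
    rw [htt]
    linarith
  · -- the Landau bound
    refine (tssC_prod_primeFactors_pow_le hPi0 hPiR t).trans (pow_le_pow_left₀ ?_ ?_ t)
    · have h1 : (1 : ℝ) ≤ 3 ^ 9 * (N : ℝ) ^ (2 * (t * t)) :=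
        one_le_mul_of_one_le_of_one_le (by norm_num) (one_le_pow₀ (by exact_mod_cast hN1))
      have := Real.log_nonneg h1
      positivity
    · refine mul_le_mul_of_nonneg_left ?_ (by positivity)
      rw [Real.log_mul (by norm_num) (by positivity), Real.log_pow, Real.log_pow, htt]
      push_cast
      nlinarith
  · -- rough primes: `p > L ≥ |a_i|`, so `p ∤ a_i`
    intro p hp hLp i
    refine card_rootSet_le_one t Ψ p hp i fun h => ?_
    rw [Int.natCast_dvd] at h
    have h1 := Nat.le_of_dvd (Int.natAbs_pos.mpr (coeff_zero_ne_zero hΨ i)) h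
    have h2 := (natAbs_le_of_affLinSize_le hN1 hL i).1
    omega
  · -- generic primes: `p ∤ Π`
    intro p hp hpQ i
    have hndvd : ¬ p ∣ Pi := fun h => hpQ (Nat.mem_primeFactors.mpr ⟨hp, h, hPi0⟩)
    refine tssC_rootSet_generic Ψ hp (fun i h => hndvd ?_) (fun i j hij h => hndvd ?_) i
    · rw [Int.natCast_dvd] at h
      exact h.trans (hdvdA i)
    · rw [Int.natCast_dvd] at h
      exact h.trans (hdvdM i j hij)

end Summit.Parity.GeneralizedHardyLittlewood.Cruxes.RelativeDimOne.SingleMoebiusSplit
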